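import Summits.HodgeConjecture.HodgeConjecture.Theorems.F0P2oLocalLettersHold       -- ★ `xiLocalPacket_nonsplit_isThetaPair_holds` (the local theta pair, hypothesis-free), `keysCaseTwoReducible_holds`
import Summits.HodgeConjecture.HodgeConjecture.Theorems.F0P3KeysCaseTwoOfStubs       -- ★ `keysCaseTwo_of_N4` (Keys' case two ⟸ N4 + ★ N5)
import Literature.NumberTheory.GelbartRogawski1991.XiLocalPacketNonsplitThetaPair    -- ★ the letter `xiLocalPacket_nonsplit_isThetaPair` (binders reused verbatim)
import Literature.NumberTheory.Rogawski1990.U3PrincipalSeriesReducibility            -- ★ NF1 `KeysCaseTwo`, `IrrClass.IsSquareIntegrable`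
import Literature.NumberTheory.Rogawski1990.CMLocalAPacketMembers                    -- ★ `KeysCaseTwoLabels`, `Gqs`, `qsForm`
import Literature.NumberTheory.Rogawski1990.SemilocalQuadraticCharExtension          -- ★ `isQuadraticCharExtension_semilocalComponent_of_baseChange_eq`
import Literature.NumberTheory.Automorphic.TorusCharacterLocalComponents             -- ★ `continuous_semilocalComponent`, `continuous_torusLocalComponent`
import HarnessLib

/-!
# F0 · P3c · line LH10 «(D-b)ᵀ» — ORGAN (TPᴸ): THE LOCAL THETA PAIR AT THE (D-b)ᵀ LABEL, HYPOTHESIS-FREE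

Cell `pub/hodgecm-mathlib`, crux H413 = `stmt-HodgeConjecture-24833` (lane `--supports`), route HCCMUnconditional; seat LH10-p01 (g0), DEFAULT organ named on the
squad bus `F0/P3c/STATUS.md` 2026-09-02 (line LH10 = books #76 (D-b)ᵀ [GelbartRogawski1991 §5.1 Lem. 5.1.2, non-split], dealer LH10-plan).  THEOREMS ONLY, sorry-free,
no definition ∕ instance ∕ notation ∕ named fact.  HONEST LABEL: HC_CM is proved only modulo the printed citations (2 remaining named inputs hLiu418 24832, h413 24833)
until rung 0 closes; this file proves no letter of (D-b)ᵀ's print debt — it moves the tree's ★ LOCAL THETA PAIR onto (D-b)ᵀ's binder block, so that a pay-down of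
★ `GelbartRogawski1991.piSCompletion_isThetaTypeAtCMTest` is left with EXACTLY the docking statement «this supercuspidal theta type completes `πⁿ ∘ e` in (13.1.4) on
test functions» (GR91 Lem. 5.1.2 p. 466 read with Rogawski1990 Prop. 13.1.3 (d); GLOBAL in print).

THE MATHEMATICS.  (D-b)ᵀ (`Literature/NumberTheory/GelbartRogawski1991/PiSCompletionIsThetaTypeTest.lean` :101) quantifies, after the dictionary pair `(μ, χ_f)` of
`ξ`, over a NON-SPLIT finite place `v`, a form congruence `ᵗT̄ · H_v · T = a · Φ₃` (`e := (cmDatumLocalCongr L v T ha h)⁻¹`), a Haar measure `μZ` on `U(Φ₃)(L⁺_v) ⧸ Z`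
and a Keys-LABELLED pair `(π², πⁿ)` of `JH(i_G(χ_ξ))` (★ `KeysCaseTwoLabels`: the constituents are exactly `{πⁿ, π²}`) with `πⁿ` NOT square-integrable for `μZ`.
The tree's ★ letter `xiLocalPacket_nonsplit_isThetaPair` (PROVED hypothesis-free: ★ `F0P2oLocalLettersHold.xiLocalPacket_nonsplit_isThetaPair_holds`, over the N3
road) produces at the same data a NON-L² constituent `x₀` with `x₀ ∘ e = X_v(μ, εn, χ_f) ∘ κ_v⁻¹` and a SUPERCUSPIDAL `πs ≠ x₀ ∘ e` with `πs = X_v(μ, εs, χ_f) ∘ κ_v⁻¹`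
(★ `ThetaTypeAtCM`).  Keys' case two [Rogawski1990 §12.2 (2)] (★ `KeysCaseTwo`, hypothesis-free in the tree: ★ `keysCaseTwo_of_N4` over ★ `keysCaseTwoReducible_holds`
and ★ N5) says ONE of the two constituents IS square-integrable for `μZ`; since `πⁿ` is not, `π²` is (§1), hence the letter's non-L² `x₀` is `πⁿ` (§2) and BOTH halves
of the theta pair land on (D-b)ᵀ's `πⁿ` (§2 `thetaPair_at_label`): `πⁿ ∘ e` is the theta type of one line class and some supercuspidal `πs ≠ πⁿ ∘ e` is the theta
type of another — «`Π(ϱ_v) = {πⁿ(ϱ_v), πˢ(ϱ_v)}` … `πˢ(ϱ_v)` is supercuspidal» [GR91 §1.4 p. 451], «`Π(ϱ_v) = {ω(γ_v, ψ_v, χ_v)}`» [GR91 Lem. 5.1.2 p. 466], minus the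
identification of `πs` with Rogawski's trace-pinned `πˢ(ξ_v)` [Rogawski1990 Prop. 13.1.3 (d)], which is the docking organ of line LH10 and is NOT asserted here.

* §1 `isSquareIntegrable_of_keysCaseTwoLabels` — at a non-split `v`, for Keys labels `(π², πⁿ)` at `(μω_v, η_v, ψ_v)` with `μω|_{𝕀_{L⁺}} = ω_{L/L⁺}`: `¬ πⁿ L²(μZ) → π² L²(μZ)`.
* §2 `eq_of_keysCaseTwoLabels_of_not_isSquareIntegrable` — a non-L² (for every Haar measure) constituent of `i_G(χ_ξ)` IS `πⁿ`;
  `thetaPair_at_label` — ORGAN (TPᴸ): the theta pair on (D-b)ᵀ's binders; `thetaType_pin_at_label` ∕ `exists_supercuspidal_thetaType_ne_at_label` — its two halves.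

## References
* [GelbartRogawski1991] S. Gelbart, J. Rogawski, Invent. Math. 105 (1991): §1.4 pp. 450–451; §5.1 (5.1.1) p. 465; Lem. 5.1.2 p. 466; Cor. 5.2.2 p. 467.
* [Rogawski1990] J. Rogawski, Ann. of Math. Stud. 123 (1990): §12.2 (2) pp. 173–174; §13.1 Prop. 13.1.3 (d) p. 199.
* [Keys1984] D. Keys, Math. Ann. 260 (1982)∕Compositio 51 (1984): §7 Theorem (2).
-/

set_option autoImplicit false
-- the mandated namespace has the single-problem summit's repeated segment (`HodgeConjecture.HodgeConjecture`)
set_option linter.dupNamespace false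

noncomputable section

open NumberField IsDedekindDomain MeasureTheory
open scoped Matrix

open Literature.NumberTheory Literature.NumberTheory.Automorphic Literature.NumberTheory.Automorphic.UnitaryGroup
open Literature.NumberTheory.Automorphic.IdeleClassGroup
open Literature.NumberTheory.Automorphic.Liu2021 Literature.NumberTheory.Automorphic.Liu2021.Def411WeilCarriers
open Literature.NumberTheory.GaloisRepresentations
open Literature.NumberTheory.Rogawski1990
open Literature.NumberTheory.GelbartRogawski1991

namespace Summit.HodgeConjecture.HodgeConjecture.Cruxes.H413.F0P3cDbTThetaPairAtLabel

variable (L : Type) [Field L] [NumberField L] [IsCMField L]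

/-! ## §1 Keys' case two at the global data `(μω, ξ)`: at the (D-b)ᵀ label, `π²` IS square-integrable -/

set_option synthInstance.maxHeartbeats 400000 in
set_option maxHeartbeats 8000000 in
/-- **`π²` is square-integrable at the (D-b)ᵀ label.**  At a finite place `v` of `L⁺` NOT split in `L`, for Rogawski's `μω` (`μω|_{𝕀_{L⁺}} = ω_{L/L⁺}`, so that
`μω_v|_{L⁺_vˣ} = ω_v`, ★ `isQuadraticCharExtension_semilocalComponent_of_baseChange_eq`) and a one-dimensional `ξ = (η, ψ)`, if `(π², πⁿ)` are Keys labels of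
`JH(i_G(χ_ξ))` (★ `KeysCaseTwoLabels`) and `πⁿ` is NOT square-integrable modulo the centre for the Haar measure `μZ`, then `π²` IS: by Keys' case two (★ `KeysCaseTwo`,
hypothesis-free ★ `keysCaseTwo_of_N4` ∘ ★ `keysCaseTwoReducible_holds`) exactly one of the two constituents is square-integrable for `μZ`.
[cite: Rogawski1990, §12.2 (2) pp. 173–174] [cite: Keys1984, §7 Theorem (2) p. 126] -/
theorem isSquareIntegrable_of_keysCaseTwoLabels (ξ : OneDimAutRepH L) (μω : HeckeCharacter L)
    (hquad : ∀ x : Literature.NumberTheory.GaloisRepresentations.ideleGroup ↥(maximalRealSubfield L),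
        μω (AdeleRing.ideleBaseChange (↥(maximalRealSubfield L)) L x) = quadraticHeckeCharCM L x)
    (v : HeightOneSpectrum (𝓞 ↥(maximalRealSubfield L))) (hv : ∀ w : PlacesOver L v, IsCMField.complexConj L • w.1 = w.1)
    [MeasurableSpace (Gqs L v ⧸ Subgroup.center (Gqs L v))] [BorelSpace (Gqs L v ⧸ Subgroup.center (Gqs L v))]
    (μZ : Measure (Gqs L v ⧸ Subgroup.center (Gqs L v))) [μZ.IsHaarMeasure]
    (π2 πn : IrrClass (Gqs L v))
    (hK : KeysCaseTwoLabels L v (μω.semilocalComponent L v) (torusLocalComponent L (IsCMField.complexConj L) v ξ.η)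
      (torusLocalComponent L (IsCMField.complexConj L) v ξ.ψ) π2 πn)
    (hn : ¬ πn.IsSquareIntegrable μZ) : π2.IsSquareIntegrable μZ := by
  obtain ⟨πs', πn', -, hJH', hs', -⟩ :=
    (F0P3KeysCaseTwoOfStubs.keysCaseTwo_of_N4 L (F0P2oLocalLettersHold.keysCaseTwoReducible_holds L)).exists_labels v hv
      (μω.semilocalComponent L v) (torusLocalComponent L (IsCMField.complexConj L) v ξ.η) (torusLocalComponent L (IsCMField.complexConj L) v ξ.ψ)
      (isQuadraticCharExtension_semilocalComponent_of_baseChange_eq μω hquad v)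
      (Units.continuous_val.comp (continuous_semilocalComponent L μω))
      (continuous_torusLocalComponent L (IsCMField.complexConj L) ξ.η) (continuous_torusLocalComponent L (IsCMField.complexConj L) ξ.ψ) μZ
  -- the square-integrable constituent `πs'` is one of the labels `{πⁿ, π²}`; it is not `πⁿ`
  rcases (hK.2 πs').1 ((hJH' πs').2 (Or.inr rfl)) with h | h
  · exact absurd (h ▸ hs') hn
  · exact h ▸ hs'

/-! ## §2 The theta pair at the label -/

set_option synthInstance.maxHeartbeats 400000 in
set_option maxHeartbeats 8000000 in
/-- **A constituent of `i_G(χ_ξ)` that is square-integrable for NO Haar measure is the Keys label `πⁿ`** (at a non-split `v`, `μω|_{𝕀_{L⁺}} = ω_{L/L⁺}`, labels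
`(π², πⁿ)` with `πⁿ` not square-integrable for `μZ`): the constituent is `πⁿ` or `π²` (★ `KeysCaseTwoLabels`), and `π²` is square-integrable for `μZ` (§1).
[cite: Rogawski1990, §12.2 (2) pp. 173–174] [cite: GelbartRogawski1991, §1.4 p. 450] -/
theorem eq_of_keysCaseTwoLabels_of_not_isSquareIntegrable (ξ : OneDimAutRepH L) (μω : HeckeCharacter L)
    (hquad : ∀ x : Literature.NumberTheory.GaloisRepresentations.ideleGroup ↥(maximalRealSubfield L),
        μω (AdeleRing.ideleBaseChange (↥(maximalRealSubfield L)) L x) = quadraticHeckeCharCM L x)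
    (v : HeightOneSpectrum (𝓞 ↥(maximalRealSubfield L))) (hv : ∀ w : PlacesOver L v, IsCMField.complexConj L • w.1 = w.1)
    [MeasurableSpace (Gqs L v ⧸ Subgroup.center (Gqs L v))] [BorelSpace (Gqs L v ⧸ Subgroup.center (Gqs L v))]
    (μZ : Measure (Gqs L v ⧸ Subgroup.center (Gqs L v))) [μZ.IsHaarMeasure]
    (π2 πn : IrrClass (Gqs L v))
    (hK : KeysCaseTwoLabels L v (μω.semilocalComponent L v) (torusLocalComponent L (IsCMField.complexConj L) v ξ.η)
      (torusLocalComponent L (IsCMField.complexConj L) v ξ.ψ) π2 πn)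
    (hn : ¬ πn.IsSquareIntegrable μZ) (x₀ : IrrClass (Gqs L v))
    (hc : x₀.IsConstituentOf (cmPrincipalSeries L 3 v (cmXiTorusChar L v (μω.semilocalComponent L v)
      (torusLocalComponent L (IsCMField.complexConj L) v ξ.η) (torusLocalComponent L (IsCMField.complexConj L) v ξ.ψ))))
    (hL2 : ∀ [MeasurableSpace (Gqs L v ⧸ Subgroup.center (Gqs L v))] [BorelSpace (Gqs L v ⧸ Subgroup.center (Gqs L v))]
        (μZ : Measure (Gqs L v ⧸ Subgroup.center (Gqs L v))) [μZ.IsHaarMeasure], ¬ x₀.IsSquareIntegrable μZ) :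
    x₀ = πn := by
  rcases (hK.2 x₀).1 hc with h | h
  · exact h
  · exact absurd (h ▸ isSquareIntegrable_of_keysCaseTwoLabels L ξ μω hquad v hv μZ π2 πn hK hn) (hL2 μZ)

set_option synthInstance.maxHeartbeats 400000 in
set_option maxHeartbeats 8000000 in
/-- **ORGAN (TPᴸ) — THE LOCAL THETA PAIR AT THE (D-b)ᵀ LABEL, hypothesis-free.**  For a CM field `L`, a hermitian `H` with unit determinant and theta frame
`(e₁, dV, g)`, a one-dimensional `ξ = (η, ψ)`, Rogawski's unitary `μω` with `μω|_{𝕀_{L⁺}} = ω_{L/L⁺}`, a pair `(μ, χ_f)` on the two DICTIONARY equations of (5.1.1), a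
finite place `v` of `L⁺` NOT split in `L`, a form congruence `ᵗT̄ · H_v · T = a · Φ₃` (`e := (cmDatumLocalCongr L v T ha h)⁻¹`), a Haar measure `μZ` on `U(Φ₃)(L⁺_v) ⧸ Z`
and Keys labels `(π², πⁿ)` of `JH(i_G(χ_ξ))` with `πⁿ` NOT square-integrable for `μZ` — EXACTLY the binders of ★ (D-b)ᵀ `piSCompletion_isThetaTypeAtCMTest` after its
transfer data — there are line classes `εn, εs` and a class `πs` of `U(H)(L⁺_v)` with: `πⁿ ∘ e` IS the local theta type `X_v(μ, εn, χ_f) ∘ κ_v⁻¹` (★ `ThetaTypeAtCM`);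
`πs` is SUPERCUSPIDAL, `πs ≠ πⁿ ∘ e`, and `πs` IS the local theta type `X_v(μ, εs, χ_f) ∘ κ_v⁻¹`.  Proof: the ★ letter `xiLocalPacket_nonsplit_isThetaPair` (PROVED in
the tree, ★ `xiLocalPacket_nonsplit_isThetaPair_holds`) at these data, whose non-L² constituent `x₀` is `πⁿ` by `eq_of_keysCaseTwoLabels_of_not_isSquareIntegrable`.
What is NOT proved here (the docking organ of line LH10): that this `πs` completes `πⁿ ∘ e` in the character identity (13.1.4) on test functions, i.e. is Rogawski's
trace-pinned `πˢ(ξ_v)`. [cite: GelbartRogawski1991, §1.4 pp. 450–451; Lem. 5.1.2 p. 466; Cor. 5.2.2 p. 467] [cite: Rogawski1990, §12.2 (2) pp. 173–174; §13.1 p. 199] -/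
theorem thetaPair_at_label (H : Matrix (Fin 3) (Fin 3) L) (hH : (H.map (cmConjRingHom L))ᵀ = H) (hHd : IsUnit H.det)
    {n' : ℕ} (e₁ : Fin 3 × Fin 1 ≃ Fin n') (dV : Fin 3 → L) (hdV : ∀ i, IsCMField.complexConj L (dV i) = dV i) (hdV0 : ∀ i, dV i ≠ 0) (g : GL (Fin 3) L)
    (hg : ((g : Matrix (Fin 3) (Fin 3) L).map (cmConjRingHom L))ᵀ * H * (g : Matrix (Fin 3) (Fin 3) L) = Matrix.diagonal dV)
    (ξ : OneDimAutRepH L) (μω : HeckeCharacter L) (hμu : μω.IsUnitary)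
    (hquad : ∀ x : Literature.NumberTheory.GaloisRepresentations.ideleGroup ↥(maximalRealSubfield L),
        μω (AdeleRing.ideleBaseChange (↥(maximalRealSubfield L)) L x) = quadraticHeckeCharCM L x)
    (μ : Literature.NumberTheory.Automorphic.IdeleClassGroup L →ₜ* Circle) (hμ : IsConjugateSymplectic L μ)
    (χf : UnitaryGroup.finAdelicOne (↥(maximalRealSubfield L)) L (IsCMField.complexConj L) →* ℂˣ)
    (hcont : Continuous χf) (hunit : ∀ z, ‖((χf z : ℂˣ) : ℂ)‖ = 1)
    (hμξ : ∀ v : HeightOneSpectrum (𝓞 ↥(maximalRealSubfield L)),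
        (toHeckeCharacter L μ).semilocalComponent L v = (ξ.bcη⁻¹ * ξ.bcψ⁻¹ * μω).semilocalComponent L v)
    (hχξ : ∀ z : (FiniteAdeleRing (𝓞 L) L)ˣ,
        χf (finAdelicCheck (↥(maximalRealSubfield L)) L (IsCMField.complexConj L)
            (AlgEquiv.ext fun x => by rw [AlgEquiv.mul_apply, IsCMField.complexConj_apply_apply, AlgEquiv.one_apply]) z) =
          (ξ.bcψ⁻¹ * (ξ.bcη⁻¹ * ξ.bcψ⁻¹ * μω) ^ 2)
            (Units.map (N := AdeleRing (𝓞 L) L) (MonoidHom.inr (InfiniteAdeleRing L) (FiniteAdeleRing (𝓞 L) L)) z))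
    (v : HeightOneSpectrum (𝓞 ↥(maximalRealSubfield L))) (hv : ∀ w : PlacesOver L v, IsCMField.complexConj L • w.1 = w.1)
    (T : GL (Fin 3) (UnitaryGroup.LocalRing L v)) (a : UnitaryGroup.LocalRing L v) (ha : IsUnit a)
    (h : formCongr (conjLocal L (IsCMField.complexConj L) v) T (H.map (algebraMap L (UnitaryGroup.LocalRing L v))) =
      a • (Matrix.of fun i j : Fin 3 => if i.val + j.val + 1 = 3 then (1 : L) else 0).map (algebraMap L (UnitaryGroup.LocalRing L v)))
    [MeasurableSpace (Gqs L v ⧸ Subgroup.center (Gqs L v))] [BorelSpace (Gqs L v ⧸ Subgroup.center (Gqs L v))]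
    (μZ : Measure (Gqs L v ⧸ Subgroup.center (Gqs L v))) [μZ.IsHaarMeasure]
    (π2 πn : IrrClass (Gqs L v))
    (hK : KeysCaseTwoLabels L v (μω.semilocalComponent L v) (torusLocalComponent L (IsCMField.complexConj L) v ξ.η)
      (torusLocalComponent L (IsCMField.complexConj L) v ξ.ψ) π2 πn)
    (hn : ¬ πn.IsSquareIntegrable μZ) :
    ∃ (εn εs : (↥(maximalRealSubfield L))ˣ) (πs : IrrClass ((cmDatum L 3 H).Local v)),
      ThetaTypeAtCM L H e₁ dV hdV hdV0 g hg μ hμ χf εn v (IrrClass.comap (cmDatumLocalCongr L v T ha h).symm πn) ∧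
      πs.IsSupercuspidal ∧ πs ≠ IrrClass.comap (cmDatumLocalCongr L v T ha h).symm πn ∧
      ThetaTypeAtCM L H e₁ dV hdV hdV0 g hg μ hμ χf εs v πs := by
  obtain ⟨εn, εs, x₀, πs, hc, hL2, hθn, hsc, hne, hθs⟩ :=
    F0P2oLocalLettersHold.xiLocalPacket_nonsplit_isThetaPair_holds L H hH hHd e₁ dV hdV hdV0 g hg ξ μω hμu hquad μ hμ χf hcont hunit hμξ hχξ
      v hv T a ha h
  obtain rfl : x₀ = πn :=
    eq_of_keysCaseTwoLabels_of_not_isSquareIntegrable L ξ μω hquad v hv μZ π2 πn hK hn x₀ hc (fun μZ' => hL2 μZ')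
  exact ⟨εn, εs, πs, hθn, hsc, hne, hθs⟩

set_option synthInstance.maxHeartbeats 400000 in
set_option maxHeartbeats 8000000 in
/-- **(n) AT THE (D-b)ᵀ LABEL** — «`πⁿ(ξ_v)` is a theta type»: with the binders of `thetaPair_at_label`, `πⁿ ∘ e` is the local theta type `X_v(μ, εn, χ_f) ∘ κ_v⁻¹` for
some line class `εn` (the ¬L²-labelled twin of ★ `xiLocalPacket_nonsplit_isThetaPair.pin_of_keysLabels`, which asks `π²` L² instead).
[cite: GelbartRogawski1991, §1.4 p. 450; Lem. 5.1.2 p. 466] [cite: Rogawski1990, §12.2 (2) p. 174] -/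
theorem thetaType_pin_at_label (H : Matrix (Fin 3) (Fin 3) L) (hH : (H.map (cmConjRingHom L))ᵀ = H) (hHd : IsUnit H.det)
    {n' : ℕ} (e₁ : Fin 3 × Fin 1 ≃ Fin n') (dV : Fin 3 → L) (hdV : ∀ i, IsCMField.complexConj L (dV i) = dV i) (hdV0 : ∀ i, dV i ≠ 0) (g : GL (Fin 3) L)
    (hg : ((g : Matrix (Fin 3) (Fin 3) L).map (cmConjRingHom L))ᵀ * H * (g : Matrix (Fin 3) (Fin 3) L) = Matrix.diagonal dV)
    (ξ : OneDimAutRepH L) (μω : HeckeCharacter L) (hμu : μω.IsUnitary)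
    (hquad : ∀ x : Literature.NumberTheory.GaloisRepresentations.ideleGroup ↥(maximalRealSubfield L),
        μω (AdeleRing.ideleBaseChange (↥(maximalRealSubfield L)) L x) = quadraticHeckeCharCM L x)
    (μ : Literature.NumberTheory.Automorphic.IdeleClassGroup L →ₜ* Circle) (hμ : IsConjugateSymplectic L μ)
    (χf : UnitaryGroup.finAdelicOne (↥(maximalRealSubfield L)) L (IsCMField.complexConj L) →* ℂˣ)
    (hcont : Continuous χf) (hunit : ∀ z, ‖((χf z : ℂˣ) : ℂ)‖ = 1)
    (hμξ : ∀ v : HeightOneSpectrum (𝓞 ↥(maximalRealSubfield L)),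
        (toHeckeCharacter L μ).semilocalComponent L v = (ξ.bcη⁻¹ * ξ.bcψ⁻¹ * μω).semilocalComponent L v)
    (hχξ : ∀ z : (FiniteAdeleRing (𝓞 L) L)ˣ,
        χf (finAdelicCheck (↥(maximalRealSubfield L)) L (IsCMField.complexConj L)
            (AlgEquiv.ext fun x => by rw [AlgEquiv.mul_apply, IsCMField.complexConj_apply_apply, AlgEquiv.one_apply]) z) =
          (ξ.bcψ⁻¹ * (ξ.bcη⁻¹ * ξ.bcψ⁻¹ * μω) ^ 2)
            (Units.map (N := AdeleRing (𝓞 L) L) (MonoidHom.inr (InfiniteAdeleRing L) (FiniteAdeleRing (𝓞 L) L)) z))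
    (v : HeightOneSpectrum (𝓞 ↥(maximalRealSubfield L))) (hv : ∀ w : PlacesOver L v, IsCMField.complexConj L • w.1 = w.1)
    (T : GL (Fin 3) (UnitaryGroup.LocalRing L v)) (a : UnitaryGroup.LocalRing L v) (ha : IsUnit a)
    (h : formCongr (conjLocal L (IsCMField.complexConj L) v) T (H.map (algebraMap L (UnitaryGroup.LocalRing L v))) =
      a • (Matrix.of fun i j : Fin 3 => if i.val + j.val + 1 = 3 then (1 : L) else 0).map (algebraMap L (UnitaryGroup.LocalRing L v)))
    [MeasurableSpace (Gqs L v ⧸ Subgroup.center (Gqs L v))] [BorelSpace (Gqs L v ⧸ Subgroup.center (Gqs L v))]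
    (μZ : Measure (Gqs L v ⧸ Subgroup.center (Gqs L v))) [μZ.IsHaarMeasure]
    (π2 πn : IrrClass (Gqs L v))
    (hK : KeysCaseTwoLabels L v (μω.semilocalComponent L v) (torusLocalComponent L (IsCMField.complexConj L) v ξ.η)
      (torusLocalComponent L (IsCMField.complexConj L) v ξ.ψ) π2 πn)
    (hn : ¬ πn.IsSquareIntegrable μZ) :
    ∃ εn : (↥(maximalRealSubfield L))ˣ, ThetaTypeAtCM L H e₁ dV hdV hdV0 g hg μ hμ χf εn v (IrrClass.comap (cmDatumLocalCongr L v T ha h).symm πn) := by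
  obtain ⟨εn, -, -, hθn, -, -, -⟩ :=
    thetaPair_at_label L H hH hHd e₁ dV hdV hdV0 g hg ξ μω hμu hquad μ hμ χf hcont hunit hμξ hχξ v hv T a ha h μZ π2 πn hK hn
  exact ⟨εn, hθn⟩

set_option synthInstance.maxHeartbeats 400000 in
set_option maxHeartbeats 8000000 in
/-- **(s) AT THE (D-b)ᵀ LABEL** — «another line class gives a SUPERCUSPIDAL theta type, distinct from `πⁿ ∘ e`»: with the binders of `thetaPair_at_label`, some
supercuspidal class `πs ≠ πⁿ ∘ e` of `U(H)(L⁺_v)` is the local theta type `X_v(μ, εs, χ_f) ∘ κ_v⁻¹` — the candidate for (D-b)ᵀ's `πθ`; that it completes `πⁿ ∘ e` in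
(13.1.4) on test functions is the docking organ, NOT proved here. [cite: GelbartRogawski1991, §1.4 p. 451 L1–4; Lem. 5.1.2 p. 466; Cor. 5.2.2 p. 467]
[cite: Rogawski1990, §13.1 Prop. 13.1.3 (d) p. 199] -/
theorem exists_supercuspidal_thetaType_ne_at_label (H : Matrix (Fin 3) (Fin 3) L) (hH : (H.map (cmConjRingHom L))ᵀ = H) (hHd : IsUnit H.det)
    {n' : ℕ} (e₁ : Fin 3 × Fin 1 ≃ Fin n') (dV : Fin 3 → L) (hdV : ∀ i, IsCMField.complexConj L (dV i) = dV i) (hdV0 : ∀ i, dV i ≠ 0) (g : GL (Fin 3) L)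
    (hg : ((g : Matrix (Fin 3) (Fin 3) L).map (cmConjRingHom L))ᵀ * H * (g : Matrix (Fin 3) (Fin 3) L) = Matrix.diagonal dV)
    (ξ : OneDimAutRepH L) (μω : HeckeCharacter L) (hμu : μω.IsUnitary)
    (hquad : ∀ x : Literature.NumberTheory.GaloisRepresentations.ideleGroup ↥(maximalRealSubfield L),
        μω (AdeleRing.ideleBaseChange (↥(maximalRealSubfield L)) L x) = quadraticHeckeCharCM L x)
    (μ : Literature.NumberTheory.Automorphic.IdeleClassGroup L →ₜ* Circle) (hμ : IsConjugateSymplectic L μ)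
    (χf : UnitaryGroup.finAdelicOne (↥(maximalRealSubfield L)) L (IsCMField.complexConj L) →* ℂˣ)
    (hcont : Continuous χf) (hunit : ∀ z, ‖((χf z : ℂˣ) : ℂ)‖ = 1)
    (hμξ : ∀ v : HeightOneSpectrum (𝓞 ↥(maximalRealSubfield L)),
        (toHeckeCharacter L μ).semilocalComponent L v = (ξ.bcη⁻¹ * ξ.bcψ⁻¹ * μω).semilocalComponent L v)
    (hχξ : ∀ z : (FiniteAdeleRing (𝓞 L) L)ˣ,
        χf (finAdelicCheck (↥(maximalRealSubfield L)) L (IsCMField.complexConj L)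
            (AlgEquiv.ext fun x => by rw [AlgEquiv.mul_apply, IsCMField.complexConj_apply_apply, AlgEquiv.one_apply]) z) =
          (ξ.bcψ⁻¹ * (ξ.bcη⁻¹ * ξ.bcψ⁻¹ * μω) ^ 2)
            (Units.map (N := AdeleRing (𝓞 L) L) (MonoidHom.inr (InfiniteAdeleRing L) (FiniteAdeleRing (𝓞 L) L)) z))
    (v : HeightOneSpectrum (𝓞 ↥(maximalRealSubfield L))) (hv : ∀ w : PlacesOver L v, IsCMField.complexConj L • w.1 = w.1)
    (T : GL (Fin 3) (UnitaryGroup.LocalRing L v)) (a : UnitaryGroup.LocalRing L v) (ha : IsUnit a)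
    (h : formCongr (conjLocal L (IsCMField.complexConj L) v) T (H.map (algebraMap L (UnitaryGroup.LocalRing L v))) =
      a • (Matrix.of fun i j : Fin 3 => if i.val + j.val + 1 = 3 then (1 : L) else 0).map (algebraMap L (UnitaryGroup.LocalRing L v)))
    [MeasurableSpace (Gqs L v ⧸ Subgroup.center (Gqs L v))] [BorelSpace (Gqs L v ⧸ Subgroup.center (Gqs L v))]
    (μZ : Measure (Gqs L v ⧸ Subgroup.center (Gqs L v))) [μZ.IsHaarMeasure]
    (π2 πn : IrrClass (Gqs L v))
    (hK : KeysCaseTwoLabels L v (μω.semilocalComponent L v) (torusLocalComponent L (IsCMField.complexConj L) v ξ.η)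
      (torusLocalComponent L (IsCMField.complexConj L) v ξ.ψ) π2 πn)
    (hn : ¬ πn.IsSquareIntegrable μZ) :
    ∃ (εs : (↥(maximalRealSubfield L))ˣ) (πs : IrrClass ((cmDatum L 3 H).Local v)),
      πs.IsSupercuspidal ∧ πs ≠ IrrClass.comap (cmDatumLocalCongr L v T ha h).symm πn ∧
      ThetaTypeAtCM L H e₁ dV hdV hdV0 g hg μ hμ χf εs v πs := by
  obtain ⟨-, εs, πs, -, hsc, hne, hθs⟩ :=
    thetaPair_at_label L H hH hHd e₁ dV hdV hdV0 g hg ξ μω hμu hquad μ hμ χf hcont hunit hμξ hχξ v hv T a ha h μZ π2 πn hK hn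
  exact ⟨εs, πs, hsc, hne, hθs⟩

end Summit.HodgeConjecture.HodgeConjecture.Cruxes.H413.F0P3cDbTThetaPairAtLabel

end
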